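import Literature.MathematicalPhysics.QuantumFieldTheory.Balaban1983to89.B9Eq342GreenPrimeSupBoundDecayCosh
import Literature.MathematicalPhysics.QuantumFieldTheory.Balaban1983to89.Beta.RemainderHasMajGreenPrime

/-!
# T. Bałaban, *Propagators for lattice gauge theories in a background field*, Commun. Math. Phys. **99** (1985) 389–434
# [Balaban1985BackgroundPropagators] Thm 3.1 (3.42) WITH DECAY, for print's `G′(U)`, (W)+(D-FS) INHABITED — THE NE9 OWNER's
# `B9Eq342GreenPrimeSupBoundDecayCosh.norm_GpOfU_apply_le_decay_cosh` AS THE `hG`-SHAPED `B11SectG.HasMaj` OF ROW (D4) BETWEEN THE SUP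
# SIZES OF (190): letters (T), (D-P), (D-E) only; on the chain's class (unitary `U`) letters (D-P), (D-E) only

CITATION HEADER (lean-in-tree rule 2026-08-18).  Sources: [Balaban1985BackgroundPropagators] (B9; held
`paper:balaban1985-cmp99-background-propagators`, journal page = PDF page + 388): p. 397 (3.39), Thm 3.1 (3.42) *«There exist positive constants
M₁, δ₀, a₀, B₀ dependent on d and L only … |(G′(U)λ)(x)| … ≦ B₀e^{−δ₀d(y,y′)}|λ| for x ∈ Δ(y), y ∈ Λ_j, supp λ ⊂ Δ(y′)»*, (3.24)–(3.25) p. 394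
(`Δ′_a(U) = Δ^η_U + Q′*aQ′`, `G′ = (Δ′_a)⁻¹` — the SITE operator), (3.49) p. 399 (unit blocks), (3.11) p. 392; [Balaban1984PropagatorsI] (B5)
(1.29) p. 23, Prop. 1.1 p. 33, p. 36 (the exponential weight); [Balaban1985Variational] (B11) (180) p. 306, (190) p. 308; [Balaban1984PropagatorsII]
(B6) (2.51)–(2.52) p. 232, (2.54) p. 233.  Read first-hand this gen: pp. 394–395, 399, 414–416 (see HONEST SCOPE).

WHY THIS FILE (audit cell `pub-balaban`, BINDER row (D4), OWNER lineage `b2b-balaban-beta-an4`, gen 108; the plan is gen 105's «Y2′»).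
`Beta.RemainderHasMajGreenPrime` (gen 104) turned the NE9 crew's block-road letter for `G′(U)` into the `hG`-shaped `HasMaj` of row (D4) and left
§1 `hasMaj_supSize_of_local` as the socket for the NE9 OWNER's sup-norm road.  That road is now in the tree WITH ITS WEIGHT LETTERS INHABITED:
`B9Eq342GreenPrimeSupBoundDecayCosh.norm_GpOfU_apply_le_decay_cosh` (p392315) — for `f` supported in the block `v`, `‖f(y)‖ ≤ F`, `‖f‖ ≤ √μF`,
any rate `0 ≤ a` with `0 < λ = 1 − 2d·η⁻²(cosh a − 1)`, `0 ≤ κ′ ≤ κ`, `κ′ < aL`, any bootstrap depth `k`: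
`‖(G′(U)f)(x₀)‖ ≤ B(a,k;μ)·e^{−(κ′∕2)d_m(πx₀,v)}·F`, `B(a,k;μ) = (1 + p₂C_E√μ)·2e^{a(L−1)}·Σ_{l<k}λ^{−(l+1)} + √(λ^{−k}∕c₀)·√(2e^{a(L−1)}K_d(aL−κ′))·C_E·√μ`,
modulo the letters (T) contractive transporters `hR`∕`hS`, (D-P) the block-local penalty `‖((Δ′_{a′}(U) − Δ^η_U)v)(x)‖ ≤ p₂‖P_{πx}v‖`, (D-E) the
`L²` block decay `‖P_y∘G′(U)∘P_v‖ ≤ C_Ee^{−κd_m(v,y)}` (the `cosh` weight of `B9Eq342CoshWeightSite` and the decayed free letter of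
`B5Eq129FreeResolventDecayedLetterSite` supply (W)+(D-FS) inside).  THIS FILE plugs it into the socket, the one-block mass `μ = c₀L^d` COUNTED
(`B9Eq347LocalFromBlockDecay.norm_le_sqrt_mass_mul` + `B9Eq349BlockDecayFromKernel.card_sites_block_le`):
* **`hasMaj_GpOfU_of_cosh_letters_sup`** — `HasMaj S_m S_m ((e ∘ G′(U) ∘ e⁻¹)↾ℝ) (B(a,k;c₀L^d)·e^{−(κ′∕2)·d_∞})` over the torus of blocks `UT m` in
  `toB6 (torusGeom m η₀ L₀ M₀) R H` (boxes = fibres of `blockCoord L m`), letters (T), (D-P), (D-E);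
* **`hasMaj_GpOfU_of_cosh_letters`** — the same with the kernel `B·e^{−(κ′∕(2d))·g.dist}` and the operator packaged `(𝒢.restrictScalars ℝ : 𝒴 →ₗ[ℝ] 𝒴)`,
  `𝒢 = LinearMap.toContinuousLinearMap (e ∘ G′(U) ∘ e⁻¹)` — token for token the `hG` binder of
  `Beta.RemainderChartOriginDerivative.ineq190_fderiv_chartH179_zero_of_letters`;
* **`hasMaj_GpOfU_of_cosh_letters_unitary`** — on the chain's class (unitary `U`, a `*`-trace `τ`, compatible fibre norm) (T) holds with equality
  (`B9Eq342GreenPrimeSupBound.norm_adTransportW_eq`∕`…_inv_eq`): letters (D-P) + (D-E) ONLY.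
The constant is free of the torus `m`; it is the road's and CRUDE (`√(λ^{−k}∕c₀)` carries `c₀^{−1∕2}`; the level-free `ḡ_k` of
`B5Eq129FreeResolventZoneSumLetters` and the height-free rate of `B9Eq342GreenPrimeSupBoundDecayCosh.rate_explicit` are not threaded here).

HONEST SCOPE.  [folklore] plumbing (the road's theorem BY NAME + the socket + mass counting); NO estimate of [5] is proved here; (T)∕(D-P)∕(D-E) stay
HYPOTHESES exactly as the road prints them (the NE9 programme's: (D-P) in the GLOBAL-`L²` form is `B9Eq324PenaltyPointwiseBound.norm_laplacePrimeA_sub_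
covLaplace_apply_le`; (D-E) on its window is `B9Eq349ConjugatedGreenBlockDecay.exists_block_decay_Gp`).  THE OPERATOR IS [5] THM 3.1's SITE OPERATOR
`G′(U) = (Δ^η_U + Q′*aQ′)⁻¹` ((3.24), gauge-transformation parameters), NOT Thm 3.3's BOND operator `G(U) = (Δ(U) + DR(U)D* + Q*aQ)⁻¹` ((3.26), vector
fields) on which [15]'s `G̃` of (182) is built: the junction is at the level of the SHAPE of (3.42), as for gen 104's V75.  Located this gen (pp. 399,
414–416): print proves Thm 3.3 not by a sup-norm bootstrap but by Sect. C's generalized random walk — `DRD* = DD* − DPD*` ((3.101)) with `P = I − R`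
non-local ((3.49)), cube propagators `G_□(e^{iηA}) = G_□(1)(I − V(A)G_□(1))⁻¹` ((3.86)), glue (3.87), `Δ_aG₀ = I − R` ((3.104)–(3.105)),
`G = G₀(I − R)⁻¹` ((3.106)), Thm 3.10 (3.107)–(3.108) ⟹ Thm 3.3 (p. 416) — the block-currency road of `Summit.QuantumFields.BalabanUV.Gaps.D4WalkBlock*`;
nothing of it is claimed here.  Nothing identifies Bałaban's step-`k` objects (NODE O).  Row (D4) class UNCHANGED (instance 0∕1; D4 DISCHARGE NO DATE);
NOT B12 Thm 2, NOT BetaPertH, NOT continuum, NOT Clay.  HONEST DEPENDENCY (cell line): continuum YM on T⁴ ⇐ BetaPertH ∧ nine spine estimates (0/9 proved);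
BetaPertH ⇐ (D1) ∧ (D4) ∧ CAP+tail; G-an2-4 gates asym, D1 and NE2/3/4.  NEW file importing `B9Eq342GreenPrimeSupBoundDecayCosh` +
`Beta.RemainderHasMajGreenPrime` only; nothing modified; 0 `def`; standard axioms; no `sorry`.
-/

noncomputable section

open scoped BigOperators InnerProductSpace

namespace Literature.MathematicalPhysics.QuantumFieldTheory.Balaban1983to89.Beta.RemainderHasMajGreenPrimeDecayCosh

open B11SectG B11SupSize190
open B4Sect5Torus (TSite tdist ccoord tdist_nonneg)
open B4Sect5Proof (latticeConst)
open B5TorusCover (UT)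
open B9Thm34Ext (toB6)
open B9Thm37GlueTorus (torusGeom tdist1)
open B9SectCLatticeCarrier (Bond shift unshift)
open B9Eq311L2Pairing (WL2)
open B9Eq319QprimeTorus (fineP blockCoord)
open B9Eq310HessianOperator (adTransportW)
open B11Eq103H1Complex (SiteL2K covLaplaceSiteK)
open B9Eq3119DeltaPiCarrier (laplacePrimeA GpOfU)
open B9Eq342GreenPrimeSupBound (norm_adTransportW_eq norm_adTransportW_inv_eq)
open B9Eq342GreenPrimeSupBoundDecayCosh (norm_GpOfU_apply_le_decay_cosh)
open B9Eq347LocalFromBlockDecay (norm_le_sqrt_mass_mul)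
open B9Eq349BlockDecayFromKernel (card_sites_block_le)
open Beta.RemainderHasMajGreenPrime (hasMaj_supSize_of_local)

/-! ### Torus bookkeeping (as in `Beta.RemainderHasMajGreenPrime`; private) -/

section Aux

variable {d : ℕ} {m : Fin d → ℕ}

/-- `ofSite a = y ↔ a = toSite y`. [folklore] -/
private theorem ofSite_eq_iff (a : TSite d m) (y : UT m) : UT.ofSite m a = y ↔ a = UT.toSite m y := by
  constructor
  · rintro rfl; rfl
  · rintro rfl; rfl

/-- The boxes of the block map are its fibres. [folklore] -/
private theorem mem_box_iff {L : ℕ} (y : UT m) (x : TSite d (fineP L m)) :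
    x ∈ (Finset.univ.filter fun x : TSite d (fineP L m) => blockCoord L m x = UT.toSite m y) ↔
      UT.ofSite m (blockCoord L m x) = y := by
  rw [Finset.mem_filter, ofSite_eq_iff]
  simp

variable [∀ i, NeZero (m i)]

/-- `d₁ ≤ d·d_∞` on the torus of blocks. [folklore] -/
private theorem tdist1_le_mul_tdist (y v : UT m) :
    tdist1 m y v ≤ d * tdist m (UT.toSite m y) (UT.toSite m v) := by
  unfold tdist1 tdist
  have h : ∀ i ∈ (Finset.univ : Finset (Fin d)),
      ((ccoord m (UT.toSite m y) (UT.toSite m v) i : ℕ) : ℝ) ≤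
        ((Finset.univ.sup (ccoord m (UT.toSite m y) (UT.toSite m v)) : ℕ) : ℝ) :=
    fun i hi => by exact_mod_cast Finset.le_sup (f := ccoord m (UT.toSite m y) (UT.toSite m v)) hi
  calc ∑ i, ((ccoord m (UT.toSite m y) (UT.toSite m v) i : ℕ) : ℝ)
      ≤ ∑ _i : Fin d, ((Finset.univ.sup (ccoord m (UT.toSite m y) (UT.toSite m v)) : ℕ) : ℝ) :=
        Finset.sum_le_sum h
    _ = d * ((Finset.univ.sup (ccoord m (UT.toSite m y) (UT.toSite m v)) : ℕ) : ℝ) := by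
        rw [Finset.sum_const, Finset.card_univ, Fintype.card_fin, nsmul_eq_mul]

/-- `e^{−r·d_∞} ≤ e^{−(r/d)·d₁}` for `r ≥ 0`. [folklore] -/
private theorem exp_tdist_le_exp_tdist1 {r : ℝ} (hr : 0 ≤ r) (y v : UT m) :
    Real.exp (-(r * tdist m (UT.toSite m y) (UT.toSite m v))) ≤ Real.exp (-(r / d * tdist1 m y v)) := by
  refine Real.exp_le_exp.mpr (neg_le_neg ?_)
  have h1 := tdist1_le_mul_tdist y v
  have ht : 0 ≤ tdist m (UT.toSite m y) (UT.toSite m v) := tdist_nonneg _ _ _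
  rcases Nat.eq_zero_or_pos d with hd | hd
  · subst hd
    simp only [Nat.cast_zero, div_zero, zero_mul]
    exact mul_nonneg hr ht
  · have hd' : (0 : ℝ) < d := by exact_mod_cast hd
    calc r / d * tdist1 m y v ≤ r / d * (d * tdist m (UT.toSite m y) (UT.toSite m v)) :=
          mul_le_mul_of_nonneg_left h1 (div_nonneg hr hd'.le)
      _ = r * tdist m (UT.toSite m y) (UT.toSite m v) := by
          field_simp

end Aux

/-! ## The road's (3.42) with the `cosh` weight IS the `hG`-shaped `HasMaj`; letters (T), (D-P), (D-E) -/

section Road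

variable {d : ℕ} (L : ℕ) [NeZero L] (m : Fin d → ℕ) [∀ i, NeZero (m i)]
  {𝔸 : Type*} [Ring 𝔸] [Algebra ℂ 𝔸]
  {W : Type} [NormedAddCommGroup W] [InnerProductSpace ℂ W] [FiniteDimensional ℂ W] (φ : W ≃ₗ[ℂ] 𝔸) {c₀ : ℝ} [Fact (0 < c₀)]
  (η : ℝ) (U : Bond d (fineP L m) → 𝔸ˣ) {c₁ : ℝ} [Fact (0 < c₁)] (a' : ℝ)
  (hpos' : ∀ x : SiteL2K ℂ d (fineP L m) c₀ W, x ≠ 0 → 0 < RCLike.re ⟪x, laplacePrimeA L m φ η U a' (c₁ := c₁) x⟫_ℂ)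
  (η₀ L₀ M₀ R : ℝ) (H : Prop)

/-- **[B9] THM 3.1 (3.42) FOR `G′(U)` AS `HasMaj S_m S_m (G′(U)↾ℝ) (B(a,k)·e^{−(κ′∕2)·d_∞})`, (W)+(D-FS) INHABITED BY THE `cosh` WEIGHT.**
Letters exactly as in `B9Eq342GreenPrimeSupBoundDecayCosh.norm_GpOfU_apply_le_decay_cosh`: (T) `hR`∕`hS`, a (K1) block family `hPS`, (D-P) `hP`,
(D-E) `hdec` for every source block; rate data `0 ≤ a`, `0 < λ = 1 − 2d·η⁻²(cosh a − 1)`, `0 ≤ κ′ ≤ κ`, `κ′ < a·L`; depth `k`; the one-block mass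
`‖f‖ ≤ √(c₀L^d)·F` is COUNTED here.  Constant
`B(a,k) = (1 + p₂C_E√(c₀L^d))·2e^{a(L−1)}·Σ_{l<k}λ^{−(l+1)} + √(λ^{−k}∕c₀)·√(2e^{a(L−1)}·K_d(aL − κ′))·C_E·√(c₀L^d)` — free of the torus `m`.
[cite: Balaban1985BackgroundPropagators, Thm 3.1 (3.42) p.397, (3.24)–(3.25) p.394, (3.49) p.399, (3.11) p.392] [cite: Balaban1984PropagatorsI, Prop. 1.1 p.33, p.36]
[cite: Balaban1985Variational, (180) p.306, (190) p.308] [cite: Balaban1984PropagatorsII, (2.51)–(2.52) p.232] -/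
theorem hasMaj_GpOfU_of_cosh_letters_sup (hm : ∀ i, 1 ≤ m i)
    (hR : ∀ b w, ‖adTransportW φ U b w‖ ≤ ‖w‖) (hS : ∀ b w, ‖adTransportW φ (fun b => (U b)⁻¹) b w‖ ≤ ‖w‖)
    {PS : TSite d m → SiteL2K ℂ d (fineP L m) c₀ W →L[ℂ] SiteL2K ℂ d (fineP L m) c₀ W}
    (hPS : ∀ (y : TSite d m) (g : SiteL2K ℂ d (fineP L m) c₀ W) (x : TSite d (fineP L m)),
      WL2.equiv ℂ (fun _ : TSite d (fineP L m) => c₀) W (PS y g) x =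
        if blockCoord L m x = y then WL2.equiv ℂ (fun _ : TSite d (fineP L m) => c₀) W g x else 0)
    {p₂ CE κ κ' a : ℝ} (hp₂ : 0 ≤ p₂) (hCE : 0 ≤ CE) (ha : 0 ≤ a) (hlam : 0 < 1 - 2 * d * (η⁻¹) ^ 2 * (Real.cosh a - 1))
    (hκ' : 0 ≤ κ') (hκ : κ' ≤ κ) (hκ₁ : κ' < a * L)
    (hP : ∀ (v : SiteL2K ℂ d (fineP L m) c₀ W) (x : TSite d (fineP L m)),
      ‖WL2.equiv ℂ _ W (laplacePrimeA L m φ η U a' (c₁ := c₁) v -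
        covLaplaceSiteK ((η : ℂ))⁻¹ (adTransportW φ U) (adTransportW φ fun b => (U b)⁻¹) v) x‖ ≤ p₂ * ‖PS (blockCoord L m x) v‖)
    (hdec : ∀ v y : TSite d m, ‖PS y ∘L LinearMap.toContinuousLinearMap (GpOfU L m φ η U a' hpos') ∘L PS v‖ ≤
      CE * Real.exp (-(κ * tdist m v y)))
    (k : ℕ) :
    HasMaj
      (supSize (toB6 (torusGeom m η₀ L₀ M₀) R H)
        (fun y => Finset.univ.filter fun x : TSite d (fineP L m) => blockCoord L m x = UT.toSite m y)
        (fun x => UT.ofSite m (blockCoord L m x)) : BlockNorm (toB6 (torusGeom m η₀ L₀ M₀) R H) (TSite d (fineP L m) → W))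
      (supSize (toB6 (torusGeom m η₀ L₀ M₀) R H)
        (fun y => Finset.univ.filter fun x : TSite d (fineP L m) => blockCoord L m x = UT.toSite m y)
        (fun x => UT.ofSite m (blockCoord L m x)))
      (((WL2.linearEquiv ℂ ℂ (fun _ : TSite d (fineP L m) => c₀) :
            SiteL2K ℂ d (fineP L m) c₀ W ≃ₗ[ℂ] (TSite d (fineP L m) → W)).toLinearMap ∘ₗ
          GpOfU L m φ η U a' (c₁ := c₁) hpos' ∘ₗ
          (WL2.linearEquiv ℂ ℂ (fun _ : TSite d (fineP L m) => c₀) :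
            SiteL2K ℂ d (fineP L m) c₀ W ≃ₗ[ℂ] (TSite d (fineP L m) → W)).symm.toLinearMap).restrictScalars ℝ)
      (fun y v => ((1 + p₂ * CE * Real.sqrt (c₀ * (L : ℝ) ^ d)) * (Real.exp (a * ((L : ℝ) - 1)) * 2) *
            (∑ l ∈ Finset.range k, ((1 - 2 * d * (η⁻¹) ^ 2 * (Real.cosh a - 1)) ^ (l + 1))⁻¹) +
          Real.sqrt (((1 - 2 * d * (η⁻¹) ^ 2 * (Real.cosh a - 1)) ^ k)⁻¹ / c₀) *
            Real.sqrt ((Real.exp (a * ((L : ℝ) - 1)) * 2) * latticeConst d (a * L - κ')) * CE * Real.sqrt (c₀ * (L : ℝ) ^ d)) *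
        Real.exp (-(κ' / 2 * tdist m (UT.toSite m y) (UT.toSite m v)))) := by
  classical
  have hc₀ : 0 < c₀ := Fact.out
  have hB0 : 0 ≤ (1 + p₂ * CE * Real.sqrt (c₀ * (L : ℝ) ^ d)) * (Real.exp (a * ((L : ℝ) - 1)) * 2) *
        (∑ l ∈ Finset.range k, ((1 - 2 * d * (η⁻¹) ^ 2 * (Real.cosh a - 1)) ^ (l + 1))⁻¹) +
      Real.sqrt (((1 - 2 * d * (η⁻¹) ^ 2 * (Real.cosh a - 1)) ^ k)⁻¹ / c₀) *
        Real.sqrt ((Real.exp (a * ((L : ℝ) - 1)) * 2) * latticeConst d (a * L - κ')) * CE * Real.sqrt (c₀ * (L : ℝ) ^ d) :=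
    add_nonneg (mul_nonneg (by positivity) (Finset.sum_nonneg fun l _ => inv_nonneg.2 (pow_nonneg hlam.le _))) (by positivity)
  refine hasMaj_supSize_of_local (fun y x => mem_box_iff y x) _ (fun y v => mul_nonneg hB0 (Real.exp_nonneg _)) ?_
  intro v f F hfv hfF x
  -- the carrier element `e⁻¹ f`, whose values are those of `f`
  set f' : SiteL2K ℂ d (fineP L m) c₀ W :=
    (WL2.linearEquiv ℂ ℂ (fun _ : TSite d (fineP L m) => c₀) :
      SiteL2K ℂ d (fineP L m) c₀ W ≃ₗ[ℂ] (TSite d (fineP L m) → W)).symm f with hf'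
  have hfv' : ∀ y, blockCoord L m y ≠ UT.toSite m v → WL2.equiv ℂ (fun _ : TSite d (fineP L m) => c₀) W f' y = 0 := by
    intro y hy
    have hne : UT.ofSite m (blockCoord L m y) ≠ v := fun h => hy ((ofSite_eq_iff _ _).1 h)
    exact hfv y hne
  have hfF' : ∀ y, ‖WL2.equiv ℂ (fun _ : TSite d (fineP L m) => c₀) W f' y‖ ≤ F := fun y => hfF y
  have hF0 : 0 ≤ F := (norm_nonneg _).trans (hfF x)
  -- the one-block mass, counted
  have hμsum : ∑ y : TSite d (fineP L m), (if blockCoord L m y = UT.toSite m v then c₀ else 0) ≤ c₀ * (L : ℝ) ^ d := by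
    rw [← Finset.sum_filter, Finset.sum_const, nsmul_eq_mul, mul_comm]
    exact mul_le_mul_of_nonneg_left (by exact_mod_cast card_sites_block_le (L := L) (m := m) (UT.toSite m v)) hc₀.le
  have hμ : ‖f'‖ ≤ Real.sqrt (c₀ * (L : ℝ) ^ d) * F :=
    norm_le_sqrt_mass_mul (𝕜 := ℂ) (w := fun _ : TSite d (fineP L m) => c₀) (π := blockCoord L m) (UT.toSite m v) hμsum f'
      hF0 hfv' hfF'
  -- the road's letter at the output site `x`, (W)+(D-FS) inhabited by the `cosh` weight centred at `x`
  have h := norm_GpOfU_apply_le_decay_cosh L m φ η U a' hpos' (c₁ := c₁) hm hR hS hPS hp₂ hCE ha hlam hκ' hκ hκ₁ hP (hdec _) x k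
    f' hfv' hfF' hμ
  exact le_of_eq_of_le rfl (h.trans_eq (by simp only [UT.toSite_ofSite]))

/-- **THE SAME IN THE GEOMETRY's OWN DISTANCE, OPERATOR AS A CONTINUOUS LINEAR MAP** — the `hG` binder of
`Beta.RemainderChartOriginDerivative.ineq190_fderiv_chartH179_zero_of_letters` token for token (`𝒵 = 𝒴 = TSite d (fineP L m) → W`, `b3 = bN = S_m`,
`B_G = B(a,k)`, `δ₀ = κ′∕(2d)`): `HasMaj S_m S_m ((𝒢.restrictScalars ℝ : 𝒴 →ₗ[ℝ] 𝒴)) (B(a,k)·e^{−(κ′∕(2d))·d_m(y,v)})`,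
`𝒢 = LinearMap.toContinuousLinearMap (e ∘ G′(U) ∘ e⁻¹)`, `d_m = (toB6 (torusGeom m η₀ L₀ M₀) R H).dist = tdist1 m` (`d₁ ≤ d·d_∞`); letters (T), (D-P), (D-E).
[cite: Balaban1985BackgroundPropagators, Thm 3.1 (3.42) p.397] [cite: Balaban1985Variational, (180) p.306, (182) p.307, (190) p.308] [cite: Balaban1984PropagatorsII, (2.51)–(2.52) p.232, (2.54) p.233] -/
theorem hasMaj_GpOfU_of_cosh_letters (hm : ∀ i, 1 ≤ m i)
    (hR : ∀ b w, ‖adTransportW φ U b w‖ ≤ ‖w‖) (hS : ∀ b w, ‖adTransportW φ (fun b => (U b)⁻¹) b w‖ ≤ ‖w‖)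
    {PS : TSite d m → SiteL2K ℂ d (fineP L m) c₀ W →L[ℂ] SiteL2K ℂ d (fineP L m) c₀ W}
    (hPS : ∀ (y : TSite d m) (g : SiteL2K ℂ d (fineP L m) c₀ W) (x : TSite d (fineP L m)),
      WL2.equiv ℂ (fun _ : TSite d (fineP L m) => c₀) W (PS y g) x =
        if blockCoord L m x = y then WL2.equiv ℂ (fun _ : TSite d (fineP L m) => c₀) W g x else 0)
    {p₂ CE κ κ' a : ℝ} (hp₂ : 0 ≤ p₂) (hCE : 0 ≤ CE) (ha : 0 ≤ a) (hlam : 0 < 1 - 2 * d * (η⁻¹) ^ 2 * (Real.cosh a - 1))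
    (hκ' : 0 ≤ κ') (hκ : κ' ≤ κ) (hκ₁ : κ' < a * L)
    (hP : ∀ (v : SiteL2K ℂ d (fineP L m) c₀ W) (x : TSite d (fineP L m)),
      ‖WL2.equiv ℂ _ W (laplacePrimeA L m φ η U a' (c₁ := c₁) v -
        covLaplaceSiteK ((η : ℂ))⁻¹ (adTransportW φ U) (adTransportW φ fun b => (U b)⁻¹) v) x‖ ≤ p₂ * ‖PS (blockCoord L m x) v‖)
    (hdec : ∀ v y : TSite d m, ‖PS y ∘L LinearMap.toContinuousLinearMap (GpOfU L m φ η U a' hpos') ∘L PS v‖ ≤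
      CE * Real.exp (-(κ * tdist m v y)))
    (k : ℕ) :
    HasMaj
      (supSize (toB6 (torusGeom m η₀ L₀ M₀) R H)
        (fun y => Finset.univ.filter fun x : TSite d (fineP L m) => blockCoord L m x = UT.toSite m y)
        (fun x => UT.ofSite m (blockCoord L m x)) : BlockNorm (toB6 (torusGeom m η₀ L₀ M₀) R H) (TSite d (fineP L m) → W))
      (supSize (toB6 (torusGeom m η₀ L₀ M₀) R H)
        (fun y => Finset.univ.filter fun x : TSite d (fineP L m) => blockCoord L m x = UT.toSite m y)
        (fun x => UT.ofSite m (blockCoord L m x)))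
      (((LinearMap.toContinuousLinearMap
          ((WL2.linearEquiv ℂ ℂ (fun _ : TSite d (fineP L m) => c₀) :
              SiteL2K ℂ d (fineP L m) c₀ W ≃ₗ[ℂ] (TSite d (fineP L m) → W)).toLinearMap ∘ₗ
            GpOfU L m φ η U a' (c₁ := c₁) hpos' ∘ₗ
            (WL2.linearEquiv ℂ ℂ (fun _ : TSite d (fineP L m) => c₀) :
              SiteL2K ℂ d (fineP L m) c₀ W ≃ₗ[ℂ] (TSite d (fineP L m) → W)).symm.toLinearMap)).restrictScalars ℝ :
          (TSite d (fineP L m) → W) →ₗ[ℝ] (TSite d (fineP L m) → W)))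
      (fun y v => ((1 + p₂ * CE * Real.sqrt (c₀ * (L : ℝ) ^ d)) * (Real.exp (a * ((L : ℝ) - 1)) * 2) *
            (∑ l ∈ Finset.range k, ((1 - 2 * d * (η⁻¹) ^ 2 * (Real.cosh a - 1)) ^ (l + 1))⁻¹) +
          Real.sqrt (((1 - 2 * d * (η⁻¹) ^ 2 * (Real.cosh a - 1)) ^ k)⁻¹ / c₀) *
            Real.sqrt ((Real.exp (a * ((L : ℝ) - 1)) * 2) * latticeConst d (a * L - κ')) * CE * Real.sqrt (c₀ * (L : ℝ) ^ d)) *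
        Real.exp (-(κ' / 2 / d * (toB6 (torusGeom m η₀ L₀ M₀) R H).dist y v))) := by
  have hc₀ : 0 < c₀ := Fact.out
  have hB0 : 0 ≤ (1 + p₂ * CE * Real.sqrt (c₀ * (L : ℝ) ^ d)) * (Real.exp (a * ((L : ℝ) - 1)) * 2) *
        (∑ l ∈ Finset.range k, ((1 - 2 * d * (η⁻¹) ^ 2 * (Real.cosh a - 1)) ^ (l + 1))⁻¹) +
      Real.sqrt (((1 - 2 * d * (η⁻¹) ^ 2 * (Real.cosh a - 1)) ^ k)⁻¹ / c₀) *
        Real.sqrt ((Real.exp (a * ((L : ℝ) - 1)) * 2) * latticeConst d (a * L - κ')) * CE * Real.sqrt (c₀ * (L : ℝ) ^ d) :=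
    add_nonneg (mul_nonneg (by positivity) (Finset.sum_nonneg fun l _ => inv_nonneg.2 (pow_nonneg hlam.le _))) (by positivity)
  have h := hasMaj_GpOfU_of_cosh_letters_sup L m φ η U a' hpos' η₀ L₀ M₀ R H (c₁ := c₁) hm hR hS hPS hp₂ hCE ha hlam hκ' hκ hκ₁ hP hdec k
  exact (h.mono fun y v => mul_le_mul_of_nonneg_left (exp_tdist_le_exp_tdist1 (div_nonneg hκ' zero_le_two) y v) hB0).congr
    fun μ => rfl

end Road

/-! ## (T) inhabited on the chain's class: unitary `U`, `*`-trace, compatible fibre norm -/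

section Unitary

variable {d : ℕ} (L : ℕ) [NeZero L] (m : Fin d → ℕ) [∀ i, NeZero (m i)]
  {𝔸 : Type*} [Ring 𝔸] [StarRing 𝔸] [Algebra ℂ 𝔸]
  {W : Type} [NormedAddCommGroup W] [InnerProductSpace ℂ W] [FiniteDimensional ℂ W] (φ : W ≃ₗ[ℂ] 𝔸) {c₀ : ℝ} [Fact (0 < c₀)]
  (η : ℝ) (U : Bond d (fineP L m) → 𝔸ˣ) {c₁ : ℝ} [Fact (0 < c₁)] (a' : ℝ)
  (hpos' : ∀ x : SiteL2K ℂ d (fineP L m) c₀ W, x ≠ 0 → 0 < RCLike.re ⟪x, laplacePrimeA L m φ η U a' (c₁ := c₁) x⟫_ℂ)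
  (η₀ L₀ M₀ R : ℝ) (H : Prop)

/-- **ON THE CHAIN's CLASS ONLY (D-P) AND (D-E) REMAIN**: for unitary `U` (`U_b* = U_b⁻¹`), a `*`-trace `τ` and the compatible fibre norm
`⟪φ⁻¹X, φ⁻¹Y⟫ = τ(X*Y)` the contraction letters (T) hold with equality (`B9Eq342GreenPrimeSupBound.norm_adTransportW_eq` ∕ `…_inv_eq`), so the
`hG`-shaped `HasMaj` of `hasMaj_GpOfU_of_cosh_letters` holds modulo the block-local penalty letter (D-P) `hP` and the `L²` block decay (D-E) `hdec` alone.
[cite: Balaban1985BackgroundPropagators, Thm 3.1 (3.42) p.397, (3.39) p.397, (3.8) p.392] [cite: Balaban1985Variational, (180) p.306, (190) p.308] -/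
theorem hasMaj_GpOfU_of_cosh_letters_unitary (hm : ∀ i, 1 ≤ m i) (τ : 𝔸 →ₗ[ℂ] ℂ) (hτ₂ : ∀ X Y : 𝔸, τ (X * Y) = τ (Y * X))
    (hU : ∀ b, star (U b : 𝔸) = ((U b)⁻¹ : 𝔸ˣ)) (hφ : ∀ X Y : 𝔸, ⟪φ.symm X, φ.symm Y⟫_ℂ = τ (star X * Y))
    {PS : TSite d m → SiteL2K ℂ d (fineP L m) c₀ W →L[ℂ] SiteL2K ℂ d (fineP L m) c₀ W}
    (hPS : ∀ (y : TSite d m) (g : SiteL2K ℂ d (fineP L m) c₀ W) (x : TSite d (fineP L m)),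
      WL2.equiv ℂ (fun _ : TSite d (fineP L m) => c₀) W (PS y g) x =
        if blockCoord L m x = y then WL2.equiv ℂ (fun _ : TSite d (fineP L m) => c₀) W g x else 0)
    {p₂ CE κ κ' a : ℝ} (hp₂ : 0 ≤ p₂) (hCE : 0 ≤ CE) (ha : 0 ≤ a) (hlam : 0 < 1 - 2 * d * (η⁻¹) ^ 2 * (Real.cosh a - 1))
    (hκ' : 0 ≤ κ') (hκ : κ' ≤ κ) (hκ₁ : κ' < a * L)
    (hP : ∀ (v : SiteL2K ℂ d (fineP L m) c₀ W) (x : TSite d (fineP L m)),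
      ‖WL2.equiv ℂ _ W (laplacePrimeA L m φ η U a' (c₁ := c₁) v -
        covLaplaceSiteK ((η : ℂ))⁻¹ (adTransportW φ U) (adTransportW φ fun b => (U b)⁻¹) v) x‖ ≤ p₂ * ‖PS (blockCoord L m x) v‖)
    (hdec : ∀ v y : TSite d m, ‖PS y ∘L LinearMap.toContinuousLinearMap (GpOfU L m φ η U a' hpos') ∘L PS v‖ ≤
      CE * Real.exp (-(κ * tdist m v y)))
    (k : ℕ) :
    HasMaj
      (supSize (toB6 (torusGeom m η₀ L₀ M₀) R H)
        (fun y => Finset.univ.filter fun x : TSite d (fineP L m) => blockCoord L m x = UT.toSite m y)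
        (fun x => UT.ofSite m (blockCoord L m x)) : BlockNorm (toB6 (torusGeom m η₀ L₀ M₀) R H) (TSite d (fineP L m) → W))
      (supSize (toB6 (torusGeom m η₀ L₀ M₀) R H)
        (fun y => Finset.univ.filter fun x : TSite d (fineP L m) => blockCoord L m x = UT.toSite m y)
        (fun x => UT.ofSite m (blockCoord L m x)))
      (((LinearMap.toContinuousLinearMap
          ((WL2.linearEquiv ℂ ℂ (fun _ : TSite d (fineP L m) => c₀) :
              SiteL2K ℂ d (fineP L m) c₀ W ≃ₗ[ℂ] (TSite d (fineP L m) → W)).toLinearMap ∘ₗ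
            GpOfU L m φ η U a' (c₁ := c₁) hpos' ∘ₗ
            (WL2.linearEquiv ℂ ℂ (fun _ : TSite d (fineP L m) => c₀) :
              SiteL2K ℂ d (fineP L m) c₀ W ≃ₗ[ℂ] (TSite d (fineP L m) → W)).symm.toLinearMap)).restrictScalars ℝ :
          (TSite d (fineP L m) → W) →ₗ[ℝ] (TSite d (fineP L m) → W)))
      (fun y v => ((1 + p₂ * CE * Real.sqrt (c₀ * (L : ℝ) ^ d)) * (Real.exp (a * ((L : ℝ) - 1)) * 2) *
            (∑ l ∈ Finset.range k, ((1 - 2 * d * (η⁻¹) ^ 2 * (Real.cosh a - 1)) ^ (l + 1))⁻¹) +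
          Real.sqrt (((1 - 2 * d * (η⁻¹) ^ 2 * (Real.cosh a - 1)) ^ k)⁻¹ / c₀) *
            Real.sqrt ((Real.exp (a * ((L : ℝ) - 1)) * 2) * latticeConst d (a * L - κ')) * CE * Real.sqrt (c₀ * (L : ℝ) ^ d)) *
        Real.exp (-(κ' / 2 / d * (toB6 (torusGeom m η₀ L₀ M₀) R H).dist y v))) :=
  hasMaj_GpOfU_of_cosh_letters L m φ η U a' hpos' η₀ L₀ M₀ R H (c₁ := c₁) hm
    (fun b w => (norm_adTransportW_eq φ U τ hτ₂ hU hφ b w).le) (fun b w => (norm_adTransportW_inv_eq φ U τ hτ₂ hU hφ b w).le)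
    hPS hp₂ hCE ha hlam hκ' hκ hκ₁ hP hdec k

end Unitary

end Literature.MathematicalPhysics.QuantumFieldTheory.Balaban1983to89.Beta.RemainderHasMajGreenPrimeDecayCosh

end
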